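import Literature.NumberTheory.ComplexMultiplication.CMOrderQuadraticBass
import HarnessLib

/-!
# Weak equivalence of fractional ideals of an order: `1 ∈ (I:J)(J:I)` ⟺ `I = LJ` with `L` invertible in the common
# multiplicator ring (Marseglia 2019, Prop. 4.1 (b)⟺(c), Cor. 4.5, Thm. 4.6 — any order), and for a quadratic order
# `I`, `J` are weakly equivalent iff `(I:I) = (J:J)`

Family `hodge`, lane `lit-hodgefound` (Track 2 foundations library; seat p15, row g24-#5 — sequel of row g24-#1
`CMOrderQuadraticBass` (every quadratic order is Bass: `I·((I:I):I) = (I:I)`, `IsUnit I ↔ (I:I) = 𝔬`)), topic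
`Literature/NumberTheory/ComplexMultiplication`.  THEOREMS ONLY: no definition, no instance, no named fact (D-0026, net
Literature debt `0`).  Carriers BY NAME: `𝔯 = endOrder ρ` (any order of any number field) / `𝔬 = endOrder (M_μ)`
(`μ : Basis (Fin 2) ℚ K`), Mathlib's `FractionalIdeal 𝔯⁰ K` with the ideal quotient `/` (`(I : J) = I / J`); «`I` and
`J` are weakly equivalent» is written as Marseglia's criterion (b) `(1 : K) ∈ I / J * (J / I)` — no definition of
`Wk(R)` is introduced.

## Source, VERBATIM

S. Marseglia, *Computing the ideal class monoid of an order*, J. Lond. Math. Soc. (2) 101 (2020) [Marseglia2019],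
held `paper:arxiv-1805.09671`, §4 pp. 8–9 (chunks p0008–p0009):

> **Proposition 4.1.** Let `I` and `J` be two fractional `R`-ideals. The following are equivalent: (a) `I_𝔭` and
> `J_𝔭` are isomorphic for every prime `𝔭` of `R`; (b) `1 ∈ (I:J)(J:I)`; (c) `I` and `J` have the same multiplicator
> ring, say `S`, and there exists an ideal `L` invertible in `S` such that `I = LJ`.
> *Proof.* […] (b)⇒(c): By definition of quotient ideal we have that `(I:J)(J:I) ⊆ (I:I)` and that
> `(I:J)(J:I) ⊆ (J:J)`. Since `(I:J)(J:I)` has a structure of both `(I:I)` and `(J:J)`-module and contains `1`, it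
> follows that `(I:I) = (I:J)(J:I) = (J:J)`, that is, `I` and `J` have the same multiplicator ring and `(I:J)` and
> `(J:I)` are inverse to each other. The following inclusions `I = I(I:I) = I(I:J)(J:I) ⊆ J(I:J) ⊆ I` are therefore
> equalities and in particular `I = LJ` for `L = (I:J)`.
> **Definition 4.2.** If two fractional `R`-ideals `I` and `J` satisfy the equivalent conditions of Proposition 4.1 we
> say that they are weakly equivalent. […] an ideal is invertible if and only if it is weakly equivalent to its
> multiplicator ring and hence we have that `W̄k(S) = {[S]}` if and only if `S` is Gorenstein.
> **Corollary 4.5.** Let `I` and `J` be two weakly equivalent fractional `R`-ideals, and let `S` be their multiplicator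
> ring. Then `I = (I:J)J`, and `(I:J)` is a fractional ideal invertible in `S`. In particular, `I ≃ J` if and only
> if `(I:J)` is a principal fractional `S`-ideal. *Proof.* […] Conversely, if `I = xJ` […] `(I:J) = (xJ:J) = x(J:J) = xS`.
> **Theorem 4.6.** Let `R` be an order in `K`. For every over-order `S` of `R`, the action of `Pic(S)` on `ICM̄(S)`
> induced by ideal multiplication is free and `W̄k(S) = ICM̄(S)/Pic(S)`. […] it is enough to prove that if `I = IJ`
> with `I` and `J` both having multiplicator ring `S` and `J` invertible in `S`, then `J = S`.

and §2 p. 5: «every order in a quadratic number field is a Bass order» (every over-order Gorenstein).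

## What is formalised

* §1 (ANY order `𝔯 = endOrder ρ`): `EndOrder.div_mul_div_le_div_self` («`(I:J)(J:I) ⊆ (I:I)`»),
  `EndOrder.div_self_mul_div_le` (`(I:I)(I:J) ⊆ (I:J)`: the `(I:I)`-module structure), **PROP. 4.1 (b)⇒(c)**:
  `EndOrder.div_mul_div_eq_div_self_of_one_mem` (`(I:J)(J:I) = (I:I)`), **`EndOrder.div_self_eq_div_self_of_one_mem`**
  (`(I:I) = (J:J)`), **`EndOrder.div_mul_eq_of_one_mem`** (COR. 4.5 `I = (I:J)J`); **PROP. 4.1 (c)⇒(b)**: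
  `EndOrder.one_mem_div_mul_div_of_mul_eq` (`I = LJ`, `J = L′I`, `1 ∈ LL′ ⟹ 1 ∈ (I:J)(J:I)`); COR. 4.5's converse
  `EndOrder.div_spanSingleton_mul_eq` (`(xJ : J) = x(J:J)`); **THM. 4.6 (freeness)**:
  `EndOrder.eq_div_self_of_mul_eq_self` (`I = IJ`, `J` invertible in `S = (I:I)` ⟹ `J = S`, by a GLOBAL argument:
  `J, J⁻¹ ⊆ (I:I)`) and `EndOrder.eq_spanSingleton_mul_div_self_of_mul_eq` (`IJ = xI ⟹ J = xS`: the action of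
  `Pic(S)` on `ICM̄(S)` is free); weak equivalence is reflexive and symmetric (`one_mem_div_self_mul_div_self`,
  `one_mem_div_mul_div_comm`).
* §2 (quadratic order `𝔬`, a Bass order): **`one_mem_div_mul_div_iff_div_self_eq`: `1 ∈ (I:J)(J:I) ⟺ (I:I) = (J:J)`**
  — two fractional ideals of a quadratic order are weakly equivalent iff they have the same multiplicator ring
  («`W̄k(S) = {[S]}` iff `S` is Gorenstein», every over-order being Gorenstein); `div_mul_eq_of_div_self_eq` (COR. 4.5:
  `(I:I) = (J:J) ⟹ I = (I:J)J`), `div_mul_div_eq_div_self_of_div_self_eq`, **`exists_invertible_mul_eq_of_div_self_eq`**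
  (THM. 4.6, transitivity: `ICM̄(S)` is ONE `Pic(S)`-orbit — with §1's freeness a `Pic(S)`-torsor, matching g24-#2's
  `#ICM_S(𝔬) = #Pic(S)`), `not_one_mem_div_mul_div_of_isUnit` (an invertible and a non-invertible ideal are never weakly
  equivalent).
* §3 Validation `ℤ[√-3]`: `EisensteinTwo.one_mem_div_mul_div_primeTwo_iff` (`M` is weakly equivalent to `𝔭₂` iff `M` is
  not invertible) — `Wk(ℤ[√-3]) = {[R], [𝔭₂]}`, one class per over-order.

NOT formalised: condition (a) (localizations `I_𝔭`), genera (Remark 4.3), the trace-dual symmetry Cor. 4.4.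

## References
* [Marseglia2019] S. Marseglia, *Computing the ideal class monoid of an order*, J. Lond. Math. Soc. (2) 101 (2020)
  984–1007, §4 Prop. 4.1, Def. 4.2, Cor. 4.5, Thm. 4.6, pp. 8–9; §2 p. 5. [cite: Marseglia2019, §4 Prop. 4.1, p. 8]
* [DadeTausskyZassenhaus1962] E. C. Dade, O. Taussky, H. Zassenhaus, *On the theory of orders …*, Math. Ann. 148 (1962)
  31–64 («proved in [DTZ] in the particular case of an integral domain»). [cite: DadeTausskyZassenhaus1962, §1]
* [Stevenhagen2008NumberRings] P. Stevenhagen, *The arithmetic of number rings*, MSRI Publ. 44 (2008), §4 Examples 4.2,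
  p. 217 (`ℤ[√-3]`). [cite: Stevenhagen2008NumberRings, §4 Examples 4.2, p. 217]
-/

noncomputable section

open scoped nonZeroDivisors NumberField Pointwise
open NumberField Module FractionalIdeal

namespace Literature.NumberTheory.ComplexMultiplication

open Literature.NumberTheory.QuadraticFields
open Literature.NumberTheory.QuadraticFields.Quadratic

/-! ## §1 Proposition 4.1 (b)⟺(c), Corollary 4.5 and Theorem 4.6 (freeness) for ANY order -/

namespace EndOrder

section AnyOrder

variable {K : Type} [Field K] [NumberField K]
variable {ι : Type} [Fintype ι] [DecidableEq ι] {ρ : K →ₐ[ℚ] Matrix ι ι ℚ}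
variable [IsFractionRing (endOrder ρ) K]

/-- **«By definition of quotient ideal we have that `(I:J)(J:I) ⊆ (I:I)`».** [cite: Marseglia2019, §4 Prop. 4.1 (proof of (b)⇒(c)), p. 8] -/
theorem div_mul_div_le_div_self {I J : FractionalIdeal (endOrder ρ)⁰ K} (hI : I ≠ 0) (hJ : J ≠ 0) :
    I / J * (J / I) ≤ I / I := by
  refine (le_div_iff_mul_le hI).2 ?_
  calc I / J * (J / I) * I = I / J * (I * (J / I)) := by rw [mul_assoc, mul_comm (J / I) I]
    _ ≤ I / J * J := mul_le_mul' le_rfl (mul_div_le hI)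
    _ = J * (I / J) := mul_comm _ _
    _ ≤ I := mul_div_le hJ

/-- **«`(I:J)(J:I)` has a structure of `(I:I)`-module»**: `(I:I)·(I:J) ⊆ (I:J)`. [cite: Marseglia2019, §4 Prop. 4.1 (proof of (b)⇒(c)), p. 8] -/
theorem div_self_mul_div_le {I J : FractionalIdeal (endOrder ρ)⁰ K} (hI : I ≠ 0) (hJ : J ≠ 0) :
    I / I * (I / J) ≤ I / J := by
  refine (le_div_iff_mul_le hJ).2 ?_
  calc I / I * (I / J) * J = I / I * (J * (I / J)) := by rw [mul_assoc, mul_comm (I / J) J]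
    _ ≤ I / I * I := mul_le_mul' le_rfl (mul_div_le hJ)
    _ = I * (I / I) := mul_comm _ _
    _ ≤ I := mul_div_le hI

/-- **PROPOSITION 4.1 (b)⇒(c), first half: `1 ∈ (I:J)(J:I) ⟹ (I:J)(J:I) = (I:I)`** («and `(I:J)` and `(J:I)` are
inverse to each other» in `S = (I:I)`). [cite: Marseglia2019, §4 Prop. 4.1 ((b)⇒(c)), p. 8] -/
theorem div_mul_div_eq_div_self_of_one_mem {I J : FractionalIdeal (endOrder ρ)⁰ K} (hI : I ≠ 0) (hJ : J ≠ 0)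
    (h1 : (1 : K) ∈ I / J * (J / I)) : I / J * (J / I) = I / I := by
  refine le_antisymm (div_mul_div_le_div_self hI hJ) fun x hx => ?_
  have hx1 : x * 1 ∈ I / I * (I / J * (J / I)) := mul_mem_mul hx h1
  rw [mul_one, ← mul_assoc] at hx1
  have hle : I / I * (I / J) * (J / I) ≤ I / J * (J / I) := mul_le_mul' (div_self_mul_div_le hI hJ) le_rfl
  exact hle hx1

/-- **PROPOSITION 4.1 (b)⇒(c): weakly equivalent ideals have the same multiplicator ring, `(I:I) = (J:J)`.**
[cite: Marseglia2019, §4 Prop. 4.1 ((b)⇒(c): «`(I:I) = (I:J)(J:I) = (J:J)`»), p. 8] -/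
theorem div_self_eq_div_self_of_one_mem {I J : FractionalIdeal (endOrder ρ)⁰ K} (hI : I ≠ 0) (hJ : J ≠ 0)
    (h1 : (1 : K) ∈ I / J * (J / I)) : I / I = J / J := by
  have h1' : (1 : K) ∈ J / I * (I / J) := by rwa [mul_comm]
  rw [← div_mul_div_eq_div_self_of_one_mem hI hJ h1, ← div_mul_div_eq_div_self_of_one_mem hJ hI h1', mul_comm]

/-- **COROLLARY 4.5: weakly equivalent ideals satisfy `I = (I:J)·J`** («the inclusions
`I = I(I:I) = I(I:J)(J:I) ⊆ J(I:J) ⊆ I` are therefore equalities»). [cite: Marseglia2019, §4 Prop. 4.1 ((b)⇒(c)) and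
Cor. 4.5, p. 8] -/
theorem div_mul_eq_of_one_mem {I J : FractionalIdeal (endOrder ρ)⁰ K} (hI : I ≠ 0) (hJ : J ≠ 0)
    (h1 : (1 : K) ∈ I / J * (J / I)) : I / J * J = I := by
  refine le_antisymm (by rw [mul_comm]; exact mul_div_le hJ) ?_
  calc I = I * (I / I) := by rw [mul_comm, div_self_mul_self_eq hI]
    _ = I / J * (I * (J / I)) := by rw [← div_mul_div_eq_div_self_of_one_mem hI hJ h1, mul_left_comm]
    _ ≤ I / J * J := mul_le_mul' le_rfl (mul_div_le hI)

/-- **PROPOSITION 4.1 (c)⇒(b): `I = LJ` and `J = L′I` with `1 ∈ LL′` (e.g. `L` invertible in the common multiplicator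
ring with inverse `L′`) ⟹ `1 ∈ (I:J)(J:I)`** (`L ⊆ (I:J)`, `L′ ⊆ (J:I)`). [cite: Marseglia2019, §4 Prop. 4.1 ((c)⇒(b)), p. 8] -/
theorem one_mem_div_mul_div_of_mul_eq {I J L L' : FractionalIdeal (endOrder ρ)⁰ K} (hI : I ≠ 0) (hJ : J ≠ 0)
    (hLJ : L * J = I) (hL'I : L' * I = J) (h1 : (1 : K) ∈ L * L') : (1 : K) ∈ I / J * (J / I) :=
  mul_le_mul' ((le_div_iff_mul_le hJ).2 hLJ.le) ((le_div_iff_mul_le hI).2 hL'I.le) h1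

/-- **COROLLARY 4.5, converse direction: «if `I = xJ` […] then `(I:J) = (xJ:J) = x(J:J) = xS`»** — isomorphic ideals
are weakly equivalent with PRINCIPAL `(I:J)`. [cite: Marseglia2019, §4 Cor. 4.5 (proof), p. 8] -/
theorem div_spanSingleton_mul_eq {J : FractionalIdeal (endOrder ρ)⁰ K} {x : K} (hx : x ≠ 0) (hJ : J ≠ 0) :
    spanSingleton (endOrder ρ)⁰ x * J / J = spanSingleton (endOrder ρ)⁰ x * (J / J) := by
  have hxJ : spanSingleton (endOrder ρ)⁰ x * J ≠ 0 := fun h => hJ (by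
    have : spanSingleton (endOrder ρ)⁰ x⁻¹ * (spanSingleton (endOrder ρ)⁰ x * J) = J := by
      rw [← mul_assoc, spanSingleton_mul_spanSingleton, inv_mul_cancel₀ hx, spanSingleton_one, one_mul]
    rw [← this, h, mul_zero])
  refine le_antisymm (fun y hy => ?_) ((le_div_iff_mul_le hJ).2 ?_)
  · rw [mem_div_iff_of_ne_zero hJ] at hy
    -- `x⁻¹ y ∈ (J:J)`
    have hy' : x⁻¹ * y ∈ J / J := by
      rw [mem_div_iff_of_ne_zero hJ]
      intro j hj
      obtain ⟨j', hj', hjj'⟩ := mem_singleton_mul.1 (hy j hj)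
      rw [mul_assoc, hjj', ← mul_assoc, inv_mul_cancel₀ hx, one_mul]
      exact hj'
    refine mem_singleton_mul.2 ⟨x⁻¹ * y, hy', ?_⟩
    rw [← mul_assoc, mul_inv_cancel₀ hx, one_mul]
  · rw [mul_assoc, div_self_mul_self_eq hJ]

/-- **THEOREM 4.6 (freeness): if `I = IJ` with `J` invertible in the multiplicator ring `S = (I:I)` (`SJ = J`,
`JJ′ = S`), then `J = S`** — by a global argument: `J ⊆ (I:I)` and `J′ ⊆ (I:I)` (as `IJ′ = IJJ′ = I`), so
`S = JJ′ ⊆ JS = J ⊆ S`. [cite: Marseglia2019, §4 Thm. 4.6 («it is enough to prove that if `I = IJ` […] then `J = S`»), p. 9] -/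
theorem eq_div_self_of_mul_eq_self {I J J' : FractionalIdeal (endOrder ρ)⁰ K} (hI : I ≠ 0) (hSJ : I / I * J = J)
    (hJJ' : J * J' = I / I) (h : I * J = I) : J = I / I := by
  have hJS : J ≤ I / I := (le_div_iff_mul_le hI).2 (by rw [mul_comm, h])
  have hJ'S : J' ≤ I / I := (le_div_iff_mul_le hI).2 (by
    calc J' * I = J' * (I * J) := by rw [h]
      _ = I * (J * J') := by rw [mul_comm J J', mul_left_comm, mul_comm]
      _ = I := by rw [hJJ', mul_comm, div_self_mul_self_eq hI]
      _ ≤ I := le_rfl)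
  refine le_antisymm hJS ?_
  calc I / I = J * J' := hJJ'.symm
    _ ≤ J * (I / I) := mul_le_mul' le_rfl hJ'S
    _ = J := by rw [mul_comm, hSJ]

/-- **THEOREM 4.6: «the action of `Pic(S)` on `ICM̄(S)` induced by ideal multiplication is free» — `[I][J] = [I]`
forces `[J] = [S]`**: `IJ = xI` with `J` invertible in `S = (I:I)` ⟹ `J = xS`. [cite: Marseglia2019, §4 Thm. 4.6, p. 9] -/
theorem eq_spanSingleton_mul_div_self_of_mul_eq {I J J' : FractionalIdeal (endOrder ρ)⁰ K} {x : K} (hx : x ≠ 0)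
    (hI : I ≠ 0) (hSJ : I / I * J = J) (hJJ' : J * J' = I / I) (h : I * J = spanSingleton (endOrder ρ)⁰ x * I) :
    J = spanSingleton (endOrder ρ)⁰ x * (I / I) := by
  have h₁ : I / I * (spanSingleton (endOrder ρ)⁰ x⁻¹ * J) = spanSingleton (endOrder ρ)⁰ x⁻¹ * J := by
    rw [mul_left_comm, hSJ]
  have h₂ : spanSingleton (endOrder ρ)⁰ x⁻¹ * J * (spanSingleton (endOrder ρ)⁰ x * J') = I / I := by
    rw [mul_mul_mul_comm, spanSingleton_mul_spanSingleton, inv_mul_cancel₀ hx, spanSingleton_one, one_mul, hJJ']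
  have h₃ : I * (spanSingleton (endOrder ρ)⁰ x⁻¹ * J) = I := by
    rw [mul_left_comm, h, ← mul_assoc, spanSingleton_mul_spanSingleton, inv_mul_cancel₀ hx, spanSingleton_one, one_mul]
  have hJ := eq_div_self_of_mul_eq_self hI h₁ h₂ h₃
  rw [← hJ, ← mul_assoc, spanSingleton_mul_spanSingleton, mul_inv_cancel₀ hx, spanSingleton_one, one_mul]

/-- Weak equivalence is reflexive: `1 ∈ (I:I)(I:I)`. [cite: Marseglia2019, §4 Def. 4.2, p. 8] -/
theorem one_mem_div_self_mul_div_self {I : FractionalIdeal (endOrder ρ)⁰ K} (hI : I ≠ 0) :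
    (1 : K) ∈ I / I * (I / I) := by
  rw [div_self_mul_div_self hI]
  exact one_mem_div_self hI

/-- Weak equivalence is symmetric. [cite: Marseglia2019, §4 Def. 4.2, p. 8] -/
theorem one_mem_div_mul_div_comm {I J : FractionalIdeal (endOrder ρ)⁰ K} :
    (1 : K) ∈ I / J * (J / I) ↔ (1 : K) ∈ J / I * (I / J) := by
  rw [mul_comm]

end AnyOrder

end EndOrder

/-! ## §2 Quadratic orders: weakly equivalent ⟺ same multiplicator ring; `ICM̄(S)` is a `Pic(S)`-torsor -/

namespace CMTypeLattice

section Quadratic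

variable {K : Type} [Field K] [NumberField K]
variable (μ : Basis (Fin 2) ℚ K) [IsFractionRing (endOrder (Algebra.leftMulMatrix μ)) K]

/-- **THEOREM 4.6 for a quadratic order, transitivity: two fractional ideals with the same multiplicator ring
`S = (I:I) = (J:J)` differ by an ideal invertible in `S`: `I = LJ`, `SL = L`, `LL′ = S`** (`L = I·(S:J)`, `L′ = J·(S:I)`,
the Bass inverses of row g24-#1) — `ICM̄(S)` is a single `Pic(S)`-orbit, PROP. 4.1 (c). [cite: Marseglia2019, §4 Thm. 4.6
and Prop. 4.1 (c), pp. 8–9] [cite: Marseglia2019, §2 («every order in a quadratic number field is a Bass order»), p. 5] -/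
theorem exists_invertible_mul_eq_of_div_self_eq {I J : FractionalIdeal (endOrder (Algebra.leftMulMatrix μ))⁰ K}
    (hI : I ≠ 0) (hJ : J ≠ 0) (h : I / I = J / J) :
    ∃ L L' : FractionalIdeal (endOrder (Algebra.leftMulMatrix μ))⁰ K,
      I / I * L = L ∧ L * L' = I / I ∧ L * J = I ∧ L' * I = J := by
  refine ⟨I * (J / J / J), J * (I / I / I), ?_, ?_, ?_, ?_⟩
  · rw [← mul_assoc, EndOrder.div_self_mul_self_eq hI]
  · rw [mul_comm J (I / I / I), mul_mul_mul_comm, mul_div_self_div_eq_div_self μ hI, mul_comm (J / J / J) J,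
      mul_div_self_div_eq_div_self μ hJ, ← h, EndOrder.div_self_mul_div_self hI]
  · rw [mul_assoc, mul_comm (J / J / J) J, mul_div_self_div_eq_div_self μ hJ, ← h, mul_comm,
      EndOrder.div_self_mul_self_eq hI]
  · rw [mul_assoc, mul_comm (I / I / I) I, mul_div_self_div_eq_div_self μ hI, h, mul_comm,
      EndOrder.div_self_mul_self_eq hJ]

/-- **Two fractional ideals of a QUADRATIC order are weakly equivalent iff they have the same multiplicator ring:
`1 ∈ (I:J)(J:I) ⟺ (I:I) = (J:J)`** — «`W̄k(S) = {[S]}` if and only if `S` is Gorenstein», and every over-order of a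
quadratic (Bass) order is Gorenstein; so `Wk(𝔬)` is the set of over-orders. [cite: Marseglia2019, §4 Prop. 4.1 and the
remark after Def. 4.2, p. 8] [cite: Marseglia2019, §2 Prop. 2.10 and «every order in a quadratic number field is a Bass
order», p. 5] -/
theorem one_mem_div_mul_div_iff_div_self_eq {I J : FractionalIdeal (endOrder (Algebra.leftMulMatrix μ))⁰ K}
    (hI : I ≠ 0) (hJ : J ≠ 0) : (1 : K) ∈ I / J * (J / I) ↔ I / I = J / J := by
  refine ⟨EndOrder.div_self_eq_div_self_of_one_mem hI hJ, fun h => ?_⟩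
  obtain ⟨L, L', -, hLL', hLJ, hL'I⟩ := exists_invertible_mul_eq_of_div_self_eq μ hI hJ h
  exact EndOrder.one_mem_div_mul_div_of_mul_eq hI hJ hLJ hL'I (hLL'.symm ▸ EndOrder.one_mem_div_self hI)

/-- **COROLLARY 4.5 for a quadratic order: `(I:I) = (J:J) ⟹ I = (I:J)·J`.** [cite: Marseglia2019, §4 Cor. 4.5, p. 8] -/
theorem div_mul_eq_of_div_self_eq {I J : FractionalIdeal (endOrder (Algebra.leftMulMatrix μ))⁰ K}
    (hI : I ≠ 0) (hJ : J ≠ 0) (h : I / I = J / J) : I / J * J = I :=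
  EndOrder.div_mul_eq_of_one_mem hI hJ ((one_mem_div_mul_div_iff_div_self_eq μ hI hJ).2 h)

/-- **`(I:J)` and `(J:I)` are mutually inverse in `S`: `(I:J)(J:I) = (I:I)`** whenever `(I:I) = (J:J)` (quadratic
order). [cite: Marseglia2019, §4 Prop. 4.1 ((b)⇒(c)) and Cor. 4.5 («`(I:J)` is a fractional ideal invertible in `S`»), p. 8] -/
theorem div_mul_div_eq_div_self_of_div_self_eq {I J : FractionalIdeal (endOrder (Algebra.leftMulMatrix μ))⁰ K}
    (hI : I ≠ 0) (hJ : J ≠ 0) (h : I / I = J / J) : I / J * (J / I) = I / I :=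
  EndOrder.div_mul_div_eq_div_self_of_one_mem hI hJ ((one_mem_div_mul_div_iff_div_self_eq μ hI hJ).2 h)

/-- **An invertible and a non-invertible ideal are never weakly equivalent** (their multiplicator rings are `𝔬` and
an over-order `≠ 𝔬`, `CMOrderQuadraticBass.isUnit_iff_div_self_eq_one`). [cite: Marseglia2019, §4 (remark after
Def. 4.2: «an ideal is invertible if and only if it is weakly equivalent to its multiplicator ring»), p. 8] -/
theorem not_one_mem_div_mul_div_of_isUnit {I J : FractionalIdeal (endOrder (Algebra.leftMulMatrix μ))⁰ K}
    (hI : IsUnit I) (hJ0 : J ≠ 0) (hJ : ¬ IsUnit J) : (1 : K) ∉ I / J * (J / I) := by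
  have hI0 : I ≠ 0 := hI.ne_zero
  intro h1
  have h := (one_mem_div_mul_div_iff_div_self_eq μ hI0 hJ0).1 h1
  rw [(isUnit_iff_div_self_eq_one μ hI0).1 hI] at h
  exact hJ ((isUnit_iff_div_self_eq_one μ hJ0).2 h.symm)

end Quadratic

/-! ## §3 Validation on `ℤ[√-3]`: `Wk(R) = {[R], [𝔭₂]}` -/

namespace EisensteinTwo

/-- **For `R = ℤ[√-3]`: a nonzero fractional ideal `M` is weakly equivalent to the singular prime `𝔭₂` iff `M` is NOT
invertible** (both then have multiplicator ring `ℤ[ζ₃] = ½𝔭₂`); with «invertible ⟺ weakly equivalent to `R`» this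
gives `Wk(ℤ[√-3]) = {[R], [𝔭₂]}`, one class per over-order. [cite: Marseglia2019, §4 Def. 4.2 (remark), p. 8]
[cite: Stevenhagen2008NumberRings, §4 Examples 4.2, p. 217] -/
theorem one_mem_div_mul_div_primeTwo_iff {M : FractionalIdeal (endOrder (Algebra.leftMulMatrix basis))⁰ K₃} (hM : M ≠ 0) :
    (1 : K₃) ∈ M / primeTwo * ((primeTwo : FractionalIdeal (endOrder (Algebra.leftMulMatrix basis))⁰ K₃) / M) ↔
      ¬ IsUnit M := by
  rw [one_mem_div_mul_div_iff_div_self_eq basis hM (coeIdeal_ne_zero.2 primeTwo_ne_bot), primeTwo_div_primeTwo,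
    not_isUnit_iff_div_self_eq_half_primeTwo hM]

end EisensteinTwo

end CMTypeLattice

end Literature.NumberTheory.ComplexMultiplication
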